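import Literature.MathematicalPhysics.QuantumFieldTheory.Balaban1983to89.B1Eq110OrbitGaussians
import Literature.MathematicalPhysics.QuantumFieldTheory.Balaban1983to89.HiggsActionIntegrable

/-!
# `Balaban1983to89.B1Eq110GaugeFixing` — T. Bałaban, *(Higgs)₂,₃ quantum fields in a finite volume. I. A lower bound*,
Commun. Math. Phys. **85** (1982) 603–626 [Balaban1982Higgs1], p. 605, (1.9)–(1.11): **THE GAUGE FIXING OF THE PARTITION FUNCTION
— `Z'^ε` (1.9) AND THE FEYNMAN-GAUGE `Z^ε` (1.10) ARE EQUAL UP TO AN EXPLICIT GAUGE-ORBIT VOLUME FACTOR — PROVED** for the massive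
abelian lattice Higgs model on the CONCRETE carrier `…Balaban1983to89.HiggsLattice` (`HiggsLattice.partitionFn` = (1.10)), for the
partition functions and for every gauge-invariant observable

statement-level skeleton of published theorems with citation tags; proofs where landed; nothing here is a claim about the Yang–Mills mass gap

PDF held: `paper:balaban1982-cmp85-higgs23-i` (journal page = PDF page + 602), p. 605 [PDF 3] (re-read on the OCR layer,
`lit read paper:balaban1982-cmp85-higgs23-i --pages 2-4`, against the typer's transcription of (1.8)–(1.11) in `…HiggsLattice`).

WHAT IS REPRODUCED.  SKELETON row **B1.Eq1.9-1.10** (owners r01/r14; cell: *"Z'^ε = ∫dA∫dφ e^{−S'^ε} (1.9), Z^ε = ∫dA∫dφ e^{−S^ε} (1.10)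
(gauge-fixed; equal up to the gauge-orbit volume factor, BFS [5])"*, status `typed`, *"gauge fixing = BFS [5] (NOT HELD)"*); DEPGRAPH
node `EXT:BFS1979` at its B1 use.  p. 605, verbatim: *"Z'^ε = ∫dA∫dφ exp(−S'^ε(A,φ)). (1.9) In the above integral the natural Lebesgue
measure is used on the spaces of configurations of scalar and vector fields. We will now use some results of the paper [5]. In
Sect. 5.1 the authors have shown how to introduce the gauge fixing terms in the integral (1.9), using the properties of (1.8) under the
gauge transformations. The same gauge fixing procedure can be applied also to gauge-invariant Schwinger functions. We introduce here
the Feynman gauge and we will consider the integral Z^ε = ∫dA∫dφ exp(−S^ε(A,φ)) (1.10) instead of (1.9), where the action S^ε is now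
defined by the formula (1.11)"* ([5] = Brydges–Fröhlich–Seiler, *On the construction of quantized gauge fields. I*, Ann. Phys. **121**
(1979) 227–284 [BrydgesFrohlichSeiler1979] — NOT HELD by this project (acquisition request acq-09341,
`run/shared/lean/pub/lit-balaban/MISSING-SOURCES.md`): NO locator inside it is asserted and NOTHING below rests on it; the gauge
fixing is PROVED here, in full, for Bałaban's model (1.8)–(1.11)).  THE THEOREMS (all `μ₀²` real unless stated; `E`, `m₀²`, `λ`, `e`,
`q`, `N`, `d`, the torus arbitrary):
* `gaugeFixing_lintegral` — **for every measurable gauge-invariant `F ≥ 0` on configurations,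
  `c · ∫dAdφ F e^{−S'^ε} = c′ · e^{E} · ∫dAdφ F e^{−S^ε}`**, where `c′ = B1Eq110OrbitGaussians.cPrime` and `c = B1Eq110OrbitGaussians.cFull` are the
  Gaussian integrals over ONE gauge orbit (gauge functions pinned at a base point) of, respectively, the Proca weight `e^{−½μ₀²‖∂^ηλ‖²}`
  of (1.8) and the Feynman-gauge weight `e^{−½μ₀²‖∂^ηλ‖² − ½‖∂^{η*}∂^ηλ‖²}` of (1.11) — the "gauge-orbit volume factor" of the row (for the
  massive model both orbit integrals are finite Gaussians; their RATIO replaces the infinite orbit volume of the massless case).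
  Mechanism (the Faddeev–Popov argument of [5] §5.1 as invoked on p. 605, made a finite-dimensional theorem): (1.11) = (1.8) +
  `½‖∂^{ε*}A‖²` + `E` (`HiggsHodgeIdentity.action_eq_actionPrime_add_divTerm`, the lattice Hodge identity); insert the Faddeev–Popov unit
  `c_FP⁻¹∫dλ e^{−½‖∂^{η*}(A+∂^ηλ)‖²} = 1` (`B1Eq110OrbitGaussians.orbP_gFP`), exchange the `λ`- and `(A,φ)`-integrations and gauge-transform
  (`B1Eq110OrbitGaussians.lintegral_mul_orbP`, `HiggsGaugeInvariance.measurePreserving_gaugeMap`, gauge invariance of `F` and of the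
  invariant part of (1.8), `psi_gaugeVec`), and evaluate the two orbit Gaussians on the transverse part `A^⊥`
  (`B1Eq110OrbitGaussians.orbM_massWeight` / `orbM_fullWeight`);
* `partitionFnPrime_eq` — **`Z'^ε = κ · e^{E} · Z^ε`** with `Z'^ε = partitionFnPrime` (the integral (1.9)), `Z^ε = HiggsLattice.partitionFn`
  (the integral (1.10)) and `κ = gaugeOrbitFactor = c′/c ∈ [1, ∞)` (`one_le_gaugeOrbitFactor`), under the paper's standing assumptions
  `μ₀² > 0`, `λ > 0` (p. 605) which make both integrals converge (`integrable_exp_neg_actionPrime`; (1.10): the tree's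
  `HiggsActionIntegrable.integrable_exp_neg_action`).
Nothing of [Balaban1982Higgs1] beyond the quoted sentences is asserted; no `Prop`-valued fact is introduced; axioms standard.
Fifth of the seat's files on the row (`…HiggsHodgeIdentity`, `…HiggsGaugeInvariance`, `…B1Eq110GaugeOrbit`,
`…B1Eq110OrbitGaussians`, this; a sixth, `…B1Eq110GaugeInvariantObservables`, passes to REAL observables and the normalised
Schwinger functions).  Unit `lit-balaban-p28` (Phase-2 proof seat p28, gen 8), HOME `run/shared/lean/pub/lit-balaban/`.
-/

open scoped BigOperators ENNReal
open _root_.MeasureTheory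

namespace Literature.MathematicalPhysics.QuantumFieldTheory.Balaban1983to89.B1Eq110GaugeFixing

open HiggsLattice HiggsCovariancePos HiggsHodgeIdentity HiggsGaugeInvariance B1Eq110GaugeOrbit B1Eq110OrbitGaussians

variable {P : Params} {k N : ℕ}

noncomputable section

/-! ## §1 Continuity bookkeeping and the scalar-field integral `Ψ(A) = ∫dφ F(A,φ) e^{−S_inv(A,φ)}` -/

/-- the invariant part of (1.8) is continuous on configuration space. [cite: Balaban1982Higgs1, (1.8) p.605] -/
theorem continuous_Sinv (C : ChargeData N) (c : Couplings) :
    Continuous fun Φ : VecField P k × ScalarField P k N => Sinv C c Φ.1 Φ.2 := by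
  have h : (fun Φ : VecField P k × ScalarField P k N => Sinv C c Φ.1 Φ.2)
      = fun Φ => action C c Φ.1 Φ.2 - massTerm c.mu0sq Φ.1 - divTerm Φ.1 - c.E := by
    funext Φ; rw [action_eq]; ring
  rw [h]
  exact (((HiggsActionIntegrable.continuous_action C c).sub ((continuous_massTerm c.mu0sq).comp continuous_fst)).sub
    (continuous_divTerm.comp continuous_fst)).sub continuous_const

/-- the action (1.8) is continuous on configuration space. [cite: Balaban1982Higgs1, (1.8) p.605] -/
theorem continuous_actionPrime (C : ChargeData N) (c : Couplings) :
    Continuous fun Φ : VecField P k × ScalarField P k N => actionPrime C c Φ.1 Φ.2 := by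
  have h : (fun Φ : VecField P k × ScalarField P k N => actionPrime C c Φ.1 Φ.2)
      = fun Φ => action C c Φ.1 Φ.2 - divTerm Φ.1 - c.E := by
    funext Φ; rw [action_eq_actionPrime_add_divTerm]; ring
  rw [h]
  exact ((HiggsActionIntegrable.continuous_action C c).sub (continuous_divTerm.comp continuous_fst)).sub continuous_const

variable (C : ChargeData N) (c : Couplings) (F : VecField P k × ScalarField P k N → ℝ≥0∞)

/-- The scalar-field integral `Ψ(A) = ∫dφ F(A,φ) exp(−S_inv(A,φ))` of a non-negative observable against the gauge-invariant part of
(1.8). [cite: Balaban1982Higgs1, (1.9) p.605] -/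
def psi (A : VecField P k) : ℝ≥0∞ := ∫⁻ φ : ScalarField P k N, F (A, φ) * ENNReal.ofReal (Real.exp (-Sinv C c A φ))

variable {C c F}

/-- measurability of the integrand of `Ψ`. [cite: Balaban1982Higgs1, (1.9) p.605] -/
theorem measurable_integrand (hF : Measurable F) :
    Measurable fun Φ : VecField P k × ScalarField P k N => F Φ * ENNReal.ofReal (Real.exp (-Sinv C c Φ.1 Φ.2)) :=
  hF.mul (ENNReal.measurable_ofReal.comp (Real.continuous_exp.comp (continuous_Sinv C c).neg).measurable)

/-- `Ψ` is measurable in `A`. [cite: Balaban1982Higgs1, (1.9) p.605] -/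
theorem measurable_psi (hF : Measurable F) : Measurable (psi C c F : VecField P k → ℝ≥0∞) :=
  (measurable_integrand hF).lintegral_prod_right'

/-- **`Ψ` IS GAUGE INVARIANT**: `Ψ(A − ∂^ηλ) = Ψ(A)` for every gauge function `λ` and every gauge-invariant `F` (change of variables
`φ ↦ U(λ)φ`, which preserves `dφ`, plus the invariance of `F` and of the invariant part of (1.8)) — p. 605 *"using the properties of
(1.8) under the gauge transformations"*. [cite: Balaban1982Higgs1, (1.9) p.605] -/
theorem psi_gaugeVec (hF : Measurable F)
    (hinv : ∀ (lam : Site P k → ℝ) (Φ : VecField P k × ScalarField P k N), F (gaugeMap C lam Φ) = F Φ)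
    (lam : Site P k → ℝ) (A : VecField P k) : psi C c F (gaugeVec lam A) = psi C c F A := by
  have hm : Measurable fun φ : ScalarField P k N =>
      F (gaugeVec lam A, φ) * ENNReal.ofReal (Real.exp (-Sinv C c (gaugeVec lam A) φ)) :=
    (measurable_integrand hF).comp (measurable_const.prodMk measurable_id)
  unfold psi
  calc ∫⁻ φ : ScalarField P k N, F (gaugeVec lam A, φ) * ENNReal.ofReal (Real.exp (-Sinv C c (gaugeVec lam A) φ))
      = ∫⁻ φ : ScalarField P k N, (fun φ' : ScalarField P k N =>
          F (gaugeVec lam A, φ') * ENNReal.ofReal (Real.exp (-Sinv C c (gaugeVec lam A) φ'))) (rot C lam φ) :=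
        ((measurePreserving_rot C lam).lintegral_comp hm).symm
    _ = ∫⁻ φ : ScalarField P k N, F (A, φ) * ENNReal.ofReal (Real.exp (-Sinv C c A φ)) := by
        refine lintegral_congr fun φ => ?_
        have h1 : F (gaugeVec lam A, rot C lam φ) = F (A, φ) := hinv lam (A, φ)
        simp only [h1, Sinv_gauge]

/-- `Ψ` is invariant along the orbit through pinned gauge functions. [cite: Balaban1982Higgs1, (1.9) p.605] -/
theorem psi_sub_grad (hF : Measurable F)
    (hinv : ∀ (lam : Site P k → ℝ) (Φ : VecField P k × ScalarField P k N), F (gaugeMap C lam Φ) = F Φ)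
    (ν : Pinned P k → ℝ) (A : VecField P k) : psi C c F (A - grad (ext0 ν)) = psi C c F A :=
  psi_gaugeVec hF hinv (ext0 ν) A

/-! ## §2 Fubini: the two integrals as `∫dA (weight)(A)·Ψ(A)` -/

/-- **(1.9) sliced**: `∫dAdφ F e^{−S'^ε} = ∫dA e^{−½μ₀²‖A‖²_η} Ψ(A)` ((1.8) = invariant part + Proca mass term).
[cite: Balaban1982Higgs1, (1.9) p.605] -/
theorem lintegral_actionPrime_eq (hF : Measurable F) :
    ∫⁻ Φ : VecField P k × ScalarField P k N, F Φ * ENNReal.ofReal (Real.exp (-actionPrime C c Φ.1 Φ.2))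
      = ∫⁻ A : VecField P k, ENNReal.ofReal (Real.exp (-massTerm c.mu0sq A)) * psi C c F A := by
  have hm : Measurable fun Φ : VecField P k × ScalarField P k N =>
      F Φ * ENNReal.ofReal (Real.exp (-actionPrime C c Φ.1 Φ.2)) :=
    hF.mul (ENNReal.measurable_ofReal.comp (Real.continuous_exp.comp (continuous_actionPrime C c).neg).measurable)
  rw [Measure.volume_eq_prod, lintegral_prod _ hm.aemeasurable]
  refine lintegral_congr fun A => ?_
  have hmA : Measurable fun φ : ScalarField P k N => F (A, φ) * ENNReal.ofReal (Real.exp (-Sinv C c A φ)) :=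
    (measurable_integrand hF).comp (measurable_const.prodMk measurable_id)
  unfold psi
  rw [← lintegral_const_mul _ hmA]
  refine lintegral_congr fun φ => ?_
  rw [actionPrime_eq, neg_add, Real.exp_add, ENNReal.ofReal_mul (Real.exp_pos _).le]
  ring

/-- **(1.10) sliced**: `∫dAdφ F e^{−S^ε} = e^{−E} ∫dA e^{−½μ₀²‖A‖²_η − ½‖∂^{η*}A‖²_η} Ψ(A)` ((1.11) = invariant part + mass term +
gauge-fixing term + `E`). [cite: Balaban1982Higgs1, (1.10) p.605] -/
theorem lintegral_action_eq (hF : Measurable F) :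
    ∫⁻ Φ : VecField P k × ScalarField P k N, F Φ * ENNReal.ofReal (Real.exp (-action C c Φ.1 Φ.2))
      = ENNReal.ofReal (Real.exp (-c.E)) *
        ∫⁻ A : VecField P k, ENNReal.ofReal (Real.exp (-(massTerm c.mu0sq A + divTerm A))) * psi C c F A := by
  have hm : Measurable fun Φ : VecField P k × ScalarField P k N =>
      F Φ * ENNReal.ofReal (Real.exp (-action C c Φ.1 Φ.2)) :=
    hF.mul (ENNReal.measurable_ofReal.comp
      (Real.continuous_exp.comp (HiggsActionIntegrable.continuous_action C c).neg).measurable)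
  have hmw : Measurable fun A : VecField P k =>
      ENNReal.ofReal (Real.exp (-(massTerm c.mu0sq A + divTerm A))) * psi C c F A :=
    (ENNReal.measurable_ofReal.comp (Real.continuous_exp.comp
      ((continuous_massTerm c.mu0sq).add continuous_divTerm).neg).measurable).mul (measurable_psi hF)
  rw [Measure.volume_eq_prod, lintegral_prod _ hm.aemeasurable, ← lintegral_const_mul _ hmw]
  refine lintegral_congr fun A => ?_
  have hmA : Measurable fun φ : ScalarField P k N => F (A, φ) * ENNReal.ofReal (Real.exp (-Sinv C c A φ)) :=
    (measurable_integrand hF).comp (measurable_const.prodMk measurable_id)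
  unfold psi
  rw [← mul_assoc, ← lintegral_const_mul _ hmA]
  refine lintegral_congr fun φ => ?_
  rw [action_eq, show -(Sinv C c A φ + massTerm c.mu0sq A + divTerm A + c.E)
      = -c.E + (-(massTerm c.mu0sq A + divTerm A) + -Sinv C c A φ) by ring, Real.exp_add, Real.exp_add,
    ENNReal.ofReal_mul (Real.exp_pos _).le, ENNReal.ofReal_mul (Real.exp_pos _).le]
  ring

/-! ## §3 The Faddeev–Popov step -/

/-- **The Faddeev–Popov step**: for a measurable weight `w` on vector fields and the gauge-invariant `Ψ`,
`c_FP · ∫dA w(A)Ψ(A) = ∫dA (∫dλ w(A − ∂^ηλ)) Ψ(A) e^{−½‖∂^{η*}A‖²}` — insert `1 = c_FP⁻¹∫dλ e^{−½‖∂*(A+∂λ)‖²}`, exchange the integrations,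
gauge-transform. [cite: Balaban1982Higgs1, (1.10) p.605] -/
theorem faddeevPopov (hF : Measurable F)
    (hinv : ∀ (lam : Site P k → ℝ) (Φ : VecField P k × ScalarField P k N), F (gaugeMap C lam Φ) = F Φ)
    (w : VecField P k → ℝ≥0∞) (hw : Measurable w) :
    cFP P k * ∫⁻ A : VecField P k, w A * psi C c F A = ∫⁻ A : VecField P k, orbM w A * psi C c F A * gFP A := by
  have hψ := measurable_psi (C := C) (c := c) hF
  have hwψ : Measurable fun A : VecField P k => w A * psi C c F A := hw.mul hψ
  calc cFP P k * ∫⁻ A : VecField P k, w A * psi C c F A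
      = ∫⁻ A : VecField P k, w A * psi C c F A * cFP P k := by rw [mul_comm, lintegral_mul_const _ hwψ]
    _ = ∫⁻ A : VecField P k, (w A * psi C c F A) * orbP gFP A := by
        refine lintegral_congr fun A => ?_; rw [orbP_gFP]
    _ = ∫⁻ A : VecField P k, orbM (fun B => w B * psi C c F B) A * gFP A :=
        lintegral_mul_orbP (fun B => w B * psi C c F B) gFP hwψ measurable_gFP
    _ = ∫⁻ A : VecField P k, orbM w A * psi C c F A * gFP A := by
        refine lintegral_congr fun A => ?_
        have hwm : Measurable fun ν : Pinned P k → ℝ => w (A - grad (ext0 ν)) :=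
          hw.comp (continuous_const.sub continuous_grad0).measurable
        have h : orbM (fun B => w B * psi C c F B) A = orbM w A * psi C c F A := by
          unfold orbM
          simp only [psi_sub_grad hF hinv]
          rw [lintegral_mul_const _ hwm]
        rw [h]

/-- `X = ∫dA e^{−½μ₀²‖A^⊥‖²} Ψ(A) e^{−½‖∂^{η*}A‖²}`, the common value of both sides after the Faddeev–Popov step.
[cite: Balaban1982Higgs1, (1.10) p.605] -/
def commonX (C : ChargeData N) (c : Couplings) (F : VecField P k × ScalarField P k N → ℝ≥0∞) : ℝ≥0∞ :=
  ∫⁻ A : VecField P k, gPerp c.mu0sq A * psi C c F A * gFP A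

/-- `c_FP · ∫dA e^{−½μ₀²‖A‖²}Ψ(A) = c′ · X`. [cite: Balaban1982Higgs1, (1.9) p.605] -/
theorem cFP_mul_massWeight (hF : Measurable F)
    (hinv : ∀ (lam : Site P k → ℝ) (Φ : VecField P k × ScalarField P k N), F (gaugeMap C lam Φ) = F Φ) :
    cFP P k * ∫⁻ A : VecField P k, ENNReal.ofReal (Real.exp (-massTerm c.mu0sq A)) * psi C c F A
      = cPrime P k c.mu0sq * commonX C c F := by
  have hw : Measurable fun B : VecField P k => ENNReal.ofReal (Real.exp (-massTerm c.mu0sq B)) :=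
    ENNReal.measurable_ofReal.comp (Real.continuous_exp.comp (continuous_massTerm c.mu0sq).neg).measurable
  rw [faddeevPopov hF hinv _ hw]
  unfold commonX
  have hm : Measurable fun A : VecField P k => gPerp c.mu0sq A * psi C c F A * gFP A :=
    ((measurable_gPerp c.mu0sq).mul (measurable_psi hF)).mul measurable_gFP
  rw [← lintegral_const_mul _ hm]
  refine lintegral_congr fun A => ?_
  rw [orbM_massWeight]
  ring

/-- `c_FP · ∫dA e^{−½μ₀²‖A‖² − ½‖∂*A‖²}Ψ(A) = c · X`. [cite: Balaban1982Higgs1, (1.10) p.605] -/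
theorem cFP_mul_fullWeight (hF : Measurable F)
    (hinv : ∀ (lam : Site P k → ℝ) (Φ : VecField P k × ScalarField P k N), F (gaugeMap C lam Φ) = F Φ) :
    cFP P k * ∫⁻ A : VecField P k, ENNReal.ofReal (Real.exp (-(massTerm c.mu0sq A + divTerm A))) * psi C c F A
      = cFull P k c.mu0sq * commonX C c F := by
  have hw : Measurable fun B : VecField P k => ENNReal.ofReal (Real.exp (-(massTerm c.mu0sq B + divTerm B))) :=
    ENNReal.measurable_ofReal.comp (Real.continuous_exp.comp ((continuous_massTerm c.mu0sq).add continuous_divTerm).neg).measurable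
  rw [faddeevPopov hF hinv _ hw]
  unfold commonX
  have hm : Measurable fun A : VecField P k => gPerp c.mu0sq A * psi C c F A * gFP A :=
    ((measurable_gPerp c.mu0sq).mul (measurable_psi hF)).mul measurable_gFP
  rw [← lintegral_const_mul _ hm]
  refine lintegral_congr fun A => ?_
  rw [orbM_fullWeight]
  ring

/-! ## §4 THE GAUGE-FIXING IDENTITY -/

/-- **GAUGE FIXING OF THE MASSIVE ABELIAN LATTICE HIGGS MODEL (Feynman gauge), for gauge-invariant observables** — p. 605, the
passage from (1.9) to (1.10) *"using the properties of (1.8) under the gauge transformations … The same gauge fixing procedure can be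
applied also to gauge-invariant Schwinger functions"*, PROVED: for every measurable `F ≥ 0` invariant under the gauge transformations
`(A,φ) ↦ (A − ∂^ελ, U(λ)φ)`,
`c · ∫dAdφ F(A,φ) e^{−S'^ε(A,φ)} = c′ · e^{E} · ∫dAdφ F(A,φ) e^{−S^ε(A,φ)}`,
`c′ = ∫dλ e^{−½μ₀²‖∂^ελ‖²}`, `c = ∫dλ e^{−½μ₀²‖∂^ελ‖² − ½‖∂^{ε*}∂^ελ‖²}` (gauge functions pinned at one site; all couplings and `E`
arbitrary real). [cite: Balaban1982Higgs1, (1.9)–(1.10) p.605] -/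
theorem gaugeFixing_lintegral (C : ChargeData N) (c : Couplings) {F : VecField P k × ScalarField P k N → ℝ≥0∞}
    (hF : Measurable F)
    (hinv : ∀ (lam : Site P k → ℝ) (Φ : VecField P k × ScalarField P k N), F (gaugeMap C lam Φ) = F Φ) :
    cFull P k c.mu0sq * ∫⁻ Φ : VecField P k × ScalarField P k N, F Φ * ENNReal.ofReal (Real.exp (-actionPrime C c Φ.1 Φ.2))
      = cPrime P k c.mu0sq * ENNReal.ofReal (Real.exp c.E) *
        ∫⁻ Φ : VecField P k × ScalarField P k N, F Φ * ENNReal.ofReal (Real.exp (-action C c Φ.1 Φ.2)) := by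
  rw [lintegral_actionPrime_eq hF, lintegral_action_eq hF]
  set I' := ∫⁻ A : VecField P k, ENNReal.ofReal (Real.exp (-massTerm c.mu0sq A)) * psi C c F A with hI'
  set I₀ := ∫⁻ A : VecField P k, ENNReal.ofReal (Real.exp (-(massTerm c.mu0sq A + divTerm A))) * psi C c F A with hI₀
  have h1 : cFP P k * I' = cPrime P k c.mu0sq * commonX C c F := cFP_mul_massWeight hF hinv
  have h2 : cFP P k * I₀ = cFull P k c.mu0sq * commonX C c F := cFP_mul_fullWeight hF hinv
  have h3 : cFP P k * (cFull P k c.mu0sq * I') = cFP P k * (cPrime P k c.mu0sq * I₀) := by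
    calc cFP P k * (cFull P k c.mu0sq * I') = cFull P k c.mu0sq * (cFP P k * I') := by ring
      _ = cFull P k c.mu0sq * (cPrime P k c.mu0sq * commonX C c F) := by rw [h1]
      _ = cPrime P k c.mu0sq * (cFull P k c.mu0sq * commonX C c F) := by ring
      _ = cPrime P k c.mu0sq * (cFP P k * I₀) := by rw [h2]
      _ = cFP P k * (cPrime P k c.mu0sq * I₀) := by ring
  have h4 : cFull P k c.mu0sq * I' = cPrime P k c.mu0sq * I₀ :=
    (ENNReal.mul_right_inj (cFP_pos (P := P) (k := k)).ne' (cFP_lt_top (P := P) (k := k)).ne).1 h3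
  have hE : ENNReal.ofReal (Real.exp c.E) * ENNReal.ofReal (Real.exp (-c.E)) = 1 := by
    rw [← ENNReal.ofReal_mul (Real.exp_pos _).le, ← Real.exp_add, add_neg_cancel, Real.exp_zero, ENNReal.ofReal_one]
  rw [h4]
  calc cPrime P k c.mu0sq * I₀ = cPrime P k c.mu0sq * (ENNReal.ofReal (Real.exp c.E) * ENNReal.ofReal (Real.exp (-c.E))) * I₀ := by
        rw [hE, mul_one]
    _ = cPrime P k c.mu0sq * ENNReal.ofReal (Real.exp c.E) * (ENNReal.ofReal (Real.exp (-c.E)) * I₀) := by ring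

/-! ## §5 The partition functions: `Z'^ε = κ e^{E} Z^ε` -/

variable (P k N) in
/-- **The partition function (1.9)** `Z'^ε = ∫dA∫dφ exp(−S'^ε(A,φ))` WITHOUT gauge fixing, *"the natural Lebesgue measure … on the spaces
of configurations of scalar and vector fields"* (product Lebesgue measure, as for `HiggsLattice.partitionFn` = (1.10)).
[cite: Balaban1982Higgs1, (1.9) p.605] -/
def partitionFnPrime (C : ChargeData N) (c : Couplings) : ℝ :=
  ∫ Φ : VecField P k × ScalarField P k N, Real.exp (-actionPrime C c Φ.1 Φ.2)

variable (P k) in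
/-- **The gauge-orbit volume factor** `κ = c′/c` relating (1.9) and (1.10) (a real number `≥ 1` for `μ₀² > 0`).
[cite: Balaban1982Higgs1, (1.9)–(1.10) p.605] -/
def gaugeOrbitFactor (mu0sq : ℝ) : ℝ := (cPrime P k mu0sq).toReal / (cFull P k mu0sq).toReal

/-- `κ ≥ 1` (the gauge-fixing term only decreases the orbit Gaussian), for `μ₀² > 0`. [cite: Balaban1982Higgs1, (1.9)–(1.10) p.605] -/
theorem one_le_gaugeOrbitFactor {mu0sq : ℝ} (hmu : 0 < mu0sq) : 1 ≤ gaugeOrbitFactor P k mu0sq := by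
  unfold gaugeOrbitFactor
  have hc : 0 < (cFull P k mu0sq).toReal := ENNReal.toReal_pos (cFull_pos mu0sq).ne' (cFull_lt_top hmu).ne
  rw [le_div_iff₀ hc, one_mul]
  exact ENNReal.toReal_mono (cPrime_lt_top hmu).ne (cFull_le_cPrime mu0sq)

/-- `κ > 0` for `μ₀² > 0`. [cite: Balaban1982Higgs1, (1.9)–(1.10) p.605] -/
theorem gaugeOrbitFactor_pos {mu0sq : ℝ} (hmu : 0 < mu0sq) : 0 < gaugeOrbitFactor P k mu0sq :=
  lt_of_lt_of_le zero_lt_one (one_le_gaugeOrbitFactor hmu)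

/-- the identity for the weights alone (`F = 1`): `c·∫e^{−S'} = c′·e^{E}·∫e^{−S}` as extended non-negative reals.
[cite: Balaban1982Higgs1, (1.9)–(1.10) p.605] -/
theorem lintegral_exp_neg_actionPrime (C : ChargeData N) (c : Couplings) :
    cFull P k c.mu0sq * ∫⁻ Φ : VecField P k × ScalarField P k N, ENNReal.ofReal (Real.exp (-actionPrime C c Φ.1 Φ.2))
      = cPrime P k c.mu0sq * ENNReal.ofReal (Real.exp c.E) *
        ∫⁻ Φ : VecField P k × ScalarField P k N, ENNReal.ofReal (Real.exp (-action C c Φ.1 Φ.2)) := by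
  have h := gaugeFixing_lintegral (P := P) (k := k) C c (F := fun _ : VecField P k × ScalarField P k N => (1 : ℝ≥0∞))
    measurable_const (fun _ _ => rfl)
  simpa only [one_mul] using h

/-- **`exp(−S'^ε)` is integrable for `dA dφ`** under the standing assumptions `μ₀² > 0`, `λ > 0` of p. 605 — so the integral (1.9)
converges (finiteness transported from (1.10) through the gauge-fixing identity). [cite: Balaban1982Higgs1, (1.9) p.605] -/
theorem integrable_exp_neg_actionPrime (C : ChargeData N) (c : Couplings) (hmu : 0 < c.mu0sq) (hlam : 0 < c.lam) :
    Integrable fun Φ : VecField P k × ScalarField P k N => Real.exp (-actionPrime C c Φ.1 Φ.2) := by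
  have hmeas : AEStronglyMeasurable (fun Φ : VecField P k × ScalarField P k N => Real.exp (-actionPrime C c Φ.1 Φ.2)) volume :=
    (Real.continuous_exp.comp (continuous_actionPrime C c).neg).aestronglyMeasurable
  refine ⟨hmeas, ?_⟩
  rw [hasFiniteIntegral_iff_ofReal (Filter.Eventually.of_forall fun Φ => (Real.exp_pos _).le)]
  have hL : ∫⁻ Φ : VecField P k × ScalarField P k N, ENNReal.ofReal (Real.exp (-action C c Φ.1 Φ.2)) < ∞ :=
    (HiggsActionIntegrable.integrable_exp_neg_action C c hmu hlam).lintegral_lt_top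
  have h := lintegral_exp_neg_actionPrime (P := P) (k := k) C c
  have hR : cPrime P k c.mu0sq * ENNReal.ofReal (Real.exp c.E) *
      ∫⁻ Φ : VecField P k × ScalarField P k N, ENNReal.ofReal (Real.exp (-action C c Φ.1 Φ.2)) ≠ ∞ :=
    ENNReal.mul_ne_top (ENNReal.mul_ne_top (cPrime_lt_top hmu).ne ENNReal.ofReal_ne_top) hL.ne
  refine lt_top_iff_ne_top.2 fun htop => hR ?_
  rw [← h, htop, ENNReal.mul_top (cFull_pos c.mu0sq).ne']

/-- **`Z'^ε = κ · e^{E} · Z^ε`** — the partition function (1.9) of the action (1.8) and the Feynman-gauge partition function (1.10)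
(`HiggsLattice.partitionFn`) of the action (1.11) agree up to the explicit gauge-orbit volume factor `κ = gaugeOrbitFactor` (and the
constant `e^{E}` which (1.11) carries and (1.8) does not), under the standing assumptions `μ₀² > 0`, `λ > 0` of p. 605.
[cite: Balaban1982Higgs1, (1.9)–(1.10) p.605] -/
theorem partitionFnPrime_eq (C : ChargeData N) (c : Couplings) (hmu : 0 < c.mu0sq) (hlam : 0 < c.lam) :
    partitionFnPrime P k N C c = gaugeOrbitFactor P k c.mu0sq * Real.exp c.E * partitionFn P k N C c := by
  have hI' := integrable_exp_neg_actionPrime (P := P) (k := k) C c hmu hlam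
  have hI := HiggsActionIntegrable.integrable_exp_neg_action (P := P) (k := k) C c hmu hlam
  have e1 : ENNReal.ofReal (partitionFnPrime P k N C c)
      = ∫⁻ Φ : VecField P k × ScalarField P k N, ENNReal.ofReal (Real.exp (-actionPrime C c Φ.1 Φ.2)) :=
    ofReal_integral_eq_lintegral_ofReal hI' (Filter.Eventually.of_forall fun Φ => (Real.exp_pos _).le)
  have e2 : ENNReal.ofReal (partitionFn P k N C c)
      = ∫⁻ Φ : VecField P k × ScalarField P k N, ENNReal.ofReal (Real.exp (-action C c Φ.1 Φ.2)) :=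
    ofReal_integral_eq_lintegral_ofReal hI (Filter.Eventually.of_forall fun Φ => (Real.exp_pos _).le)
  have h := lintegral_exp_neg_actionPrime (P := P) (k := k) C c
  rw [← e1, ← e2] at h
  have h' := congrArg ENNReal.toReal h
  have hZ' : 0 ≤ partitionFnPrime P k N C c := integral_nonneg fun Φ => (Real.exp_pos _).le
  have hZ : 0 ≤ partitionFn P k N C c := (HiggsActionIntegrable.partitionFn_pos C c hmu hlam).le
  rw [ENNReal.toReal_mul, ENNReal.toReal_mul, ENNReal.toReal_mul, ENNReal.toReal_ofReal hZ', ENNReal.toReal_ofReal hZ,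
    ENNReal.toReal_ofReal (Real.exp_pos _).le] at h'
  have hc : 0 < (cFull P k c.mu0sq).toReal := ENNReal.toReal_pos (cFull_pos c.mu0sq).ne' (cFull_lt_top hmu).ne
  unfold gaugeOrbitFactor
  field_simp
  linarith

end

end Literature.MathematicalPhysics.QuantumFieldTheory.Balaban1983to89.B1Eq110GaugeFixing
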